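import Summits.HodgeConjecture.CorCM.RationalExteriorAlgebra
import Mathlib.LinearAlgebra.Matrix.Determinant.Basic
import HarnessLib

/-!
# COR-CM model facts, exterior-algebra group: four-fold cup products of distinct members of an
# eigenbasis are linearly independent (tool for model axiom M15 `Fact_weilLine_rank`)

HONEST FRAMING (cell pub-hodgecm2 / COR-CM): STANDARD facts about Betti cohomology on the tree's real
carriers; nothing about algebraic cycles.

For a complex abelian variety `B` (think: the corner product `P = ((A₀ × A₁) × A₂) × A₃`), a `ℂ`-basis `b`
of `ℂ ⊗_ℚ H¹(B(ℂ); ℚ)` and four index maps `j₀, …, j₃ : E → J` which are JOINTLY injective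
(`jₖ σ = jₖ' τ → k = k' ∧ σ = τ`), the classes

  `g σ := (b (j₀ σ) ∪ b (j₁ σ)) ∪ (b (j₂ σ) ∪ b (j₃ σ)) ∈ ℂ ⊗_ℚ H⁴(B(ℂ); ℚ)`

(complexified cup products, the package's `quadC`/`cup2C = LinearMap.BilinMap.baseChange ℂ (cup X k k)`)
are LINEARLY INDEPENDENT over `ℂ` (`linearIndependent_quadC`). Proof: transport to `H⁴(B(ℂ); ℂ)` by the
injective complexification map (`ofRatClassBaseChange`, multiplicative: `BettiUniverse.ofRatClassBaseChange_cup2`),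
where `g σ` becomes the image of the pure wedge `b' (j₀ σ) ∧ ⋯ ∧ b' (j₃ σ)` (`b' = β ∘ b` a basis of
`H¹(B(ℂ); ℂ)`) under the comparison ISOMORPHISM `⋀⁴ H¹(B(ℂ); ℂ) ≅ H⁴(B(ℂ); ℂ)` (the tree's
`abelianVarietyCohomologyExteriorH1_holds`, Mumford §1 (4)); the linear functionals
`F σ := det[coord_{jₖ σ}(·)]ₖ ∘ (comparison)⁻¹` (a `4 × 4` determinant of coordinates is an alternating
form, `Matrix.detRowAlternating`) take the value `1` on `g σ` and `0` on `g τ`, `τ ≠ σ`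
(`LinearIndependent.of_pairwise_dual_eq_zero_one`).

In the cell this is applied with `b` the eigenbasis of `ℂ ⊗ H¹(P)` assembled from the eigenbases of the
four CM factors (`CorCM/CMEigenBasis`, `CorCM/ProductEigenbasis`), `E = (K → ℂ)` and `jₖ σ` = "the
`σ`-eigenvector pulled back from factor `k`": then the `g σ` are the Weil generators and
`dim_ℂ span(Weil generators) = [K:ℚ]`.

## References
* [MumfordAV1970] D. Mumford, *Abelian Varieties* (1970), §1 (4).
* [LangeBirkenhake1992] H. Lange, Ch. Birkenhake, *Complex Abelian Varieties* (1992), Cor. 1.1.19.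
* [Deligne1982HodgeCycles] P. Deligne, LNM 900 (1982), §4 (Weil classes as `⋀_E`).
-/

noncomputable section

open scoped TensorProduct
open CategoryTheory
open Literature.AlgebraicTopology.SingularHomology
open Literature.AlgebraicGeometry Literature.AlgebraicGeometry.Motives Literature.AlgebraicGeometry.HodgeTheory

namespace Summit.HodgeConjecture.CorCM.Model

/-- `m₄(v) = (v₀ ∪ v₁) ∪ (v₂ ∪ v₃)` for degree-one classes over any coefficient ring (associativity and
unit of the cup product). [folklore] -/
theorem cupPowOne_four' {R : Type} [CommRing R] {Y : Type} [TopologicalSpace Y]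
    (v : Fin 4 → singularCohomology R R Y 1) :
    cupPowOne R Y 4 v =
      cupProduct (rfl : 2 + 2 = 4) (cupProduct (rfl : 1 + 1 = 2) (v 0) (v 1))
        (cupProduct (rfl : 1 + 1 = 2) (v 2) (v 3)) := by
  rw [cupPowOne_succ, cupPowOne_succ, cupPowOne_succ, cupPowOne_one,
    cupProduct_assoc (rfl : 1 + 1 = 2) (rfl : 1 + 2 = 3) (rfl : 2 + 2 = 4) (rfl : 1 + 3 = 4)]
  rfl

section Quad

variable (X : SchemeOver ℂ)

/-- Complexification is multiplicative, degrees `(1,1) → 2` (the tree's `ofRatClassBaseChange_cup2` with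
the target degree spelled `2`). [folklore] -/
theorem ofRatClassBaseChange_cup11 (a c : ℂ ⊗[ℚ] bettiCohomology X 1) :
    ofRatClassBaseChange (ComplexPoints X) 2 (LinearMap.BilinMap.baseChange ℂ (BettiUniverse.cup X 1 1) a c) =
      cupProduct (rfl : 1 + 1 = 2) (ofRatClassBaseChange (ComplexPoints X) 1 a)
        (ofRatClassBaseChange (ComplexPoints X) 1 c) :=
  BettiUniverse.ofRatClassBaseChange_cup2 X 1 a c

/-- Complexification is multiplicative, degrees `(2,2) → 4`. [folklore] -/
theorem ofRatClassBaseChange_cup22 (x y : ℂ ⊗[ℚ] bettiCohomology X 2) :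
    ofRatClassBaseChange (ComplexPoints X) 4 (LinearMap.BilinMap.baseChange ℂ (BettiUniverse.cup X 2 2) x y) =
      cupProduct (rfl : 2 + 2 = 4) (ofRatClassBaseChange (ComplexPoints X) 2 x)
        (ofRatClassBaseChange (ComplexPoints X) 2 y) :=
  BettiUniverse.ofRatClassBaseChange_cup2 X 2 x y

end Quad

section Independence

variable (B : AbelianVariety ℂ) {J E : Type*}

/-- **Four-fold cups of jointly-indexed distinct basis vectors are linearly independent.** For a
complex abelian variety `B`, a `ℂ`-basis `b` of `ℂ ⊗_ℚ H¹(B(ℂ); ℚ)` and jointly injective index maps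
`j : Fin 4 → E → J`, the family `σ ↦ (b (j 0 σ) ∪ b (j 1 σ)) ∪ (b (j 2 σ) ∪ b (j 3 σ))` of complexified
cup products is linearly independent in `ℂ ⊗_ℚ H⁴(B(ℂ); ℚ)`. [cite: MumfordAV1970, §1 (4)]
[cite: Deligne1982HodgeCycles, §4] -/
theorem linearIndependent_quadC (b : Module.Basis J ℂ (ℂ ⊗[ℚ] bettiCohomology B.X 1))
    (j : Fin 4 → E → J) (hj : ∀ k k' σ τ, j k σ = j k' τ → k = k' ∧ σ = τ) :
    LinearIndependent ℂ fun σ : E ↦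
      LinearMap.BilinMap.baseChange ℂ (BettiUniverse.cup B.X 2 2)
        (LinearMap.BilinMap.baseChange ℂ (BettiUniverse.cup B.X 1 1) (b (j 0 σ)) (b (j 1 σ)))
        (LinearMap.BilinMap.baseChange ℂ (BettiUniverse.cup B.X 1 1) (b (j 2 σ)) (b (j 3 σ))) := by
  classical
  have hX : IsSmoothProjective B.dim B.X := AbelianVariety.isSmoothProjective_holds (A := B)
  -- complexified basis of `H¹(B(ℂ); ℂ)` and the exterior-algebra comparison isomorphism
  let β₁ := ofRatClassBaseChangeEquiv hX 1
  let b' : Module.Basis J ℂ (complexBetti B.X 1) := b.map β₁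
  have hb' : ∀ i, b' i = ofRatClassBaseChange (ComplexPoints B.X) 1 (b i) := fun i ↦ by
    simp only [b', Module.Basis.map_apply, β₁, ofRatClassBaseChangeEquiv_apply]
  let Eq4 := (abelianVarietyCohomologyExteriorH1_holds.hasExteriorCohomologyH1 B).equiv 4
  have hEq4 : ∀ x, Eq4 x = wedgeToCup ℂ (ComplexPoints B.X) 4 x := fun x ↦ rfl
  -- the dual functionals
  let ω : E → (complexBetti B.X 1) [⋀^Fin 4]→ₗ[ℂ] ℂ := fun σ ↦
    Matrix.detRowAlternating.compLinearMap (LinearMap.pi fun k : Fin 4 ↦ b'.coord (j k σ))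
  let F : E → Module.Dual ℂ (complexBetti B.X 4) := fun σ ↦
    (exteriorPower.alternatingMapLinearEquiv (ω σ)) ∘ₗ (Eq4.symm : complexBetti B.X 4 →ₗ[ℂ] _)
  -- transport the family to `H⁴(B(ℂ); ℂ)`
  refine LinearIndependent.of_comp (ofRatClassBaseChange (ComplexPoints B.X) 4) ?_
  have hval : ∀ τ : E, (ofRatClassBaseChange (ComplexPoints B.X) 4 ∘ fun σ : E ↦
      LinearMap.BilinMap.baseChange ℂ (BettiUniverse.cup B.X 2 2)
        (LinearMap.BilinMap.baseChange ℂ (BettiUniverse.cup B.X 1 1) (b (j 0 σ)) (b (j 1 σ)))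
        (LinearMap.BilinMap.baseChange ℂ (BettiUniverse.cup B.X 1 1) (b (j 2 σ)) (b (j 3 σ)))) τ =
      wedgeToCup ℂ (ComplexPoints B.X) 4 (exteriorPower.ιMulti ℂ 4 fun k ↦ b' (j k τ)) := by
    intro τ
    rw [Function.comp_apply, ofRatClassBaseChange_cup22, ofRatClassBaseChange_cup11, ofRatClassBaseChange_cup11,
      wedgeToCup_ιMulti, cupPowOne_four', hb', hb', hb', hb']
  have hF : ∀ σ τ : E, F σ (wedgeToCup ℂ (ComplexPoints B.X) 4 (exteriorPower.ιMulti ℂ 4 fun k ↦ b' (j k τ))) =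
      Matrix.det (Matrix.of fun k k' : Fin 4 ↦ if j k τ = j k' σ then (1 : ℂ) else 0) := by
    intro σ τ
    simp only [F, LinearMap.comp_apply, LinearEquiv.coe_coe]
    rw [← hEq4, LinearEquiv.symm_apply_apply, exteriorPower.alternatingMapLinearEquiv_apply_ιMulti]
    simp only [ω, AlternatingMap.compLinearMap_apply]
    change Matrix.det _ = Matrix.det _
    congr 1
    ext k k'
    simp only [Matrix.of_apply, LinearMap.pi_apply, Module.Basis.coord_apply, Module.Basis.repr_self,
      Finsupp.single_apply]
  refine LinearIndependent.of_pairwise_dual_eq_zero_one _ F (fun σ τ hστ ↦ ?_) (fun σ ↦ ?_)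
  · dsimp only
    rw [hval, hF]
    have h0 : (Matrix.of fun k k' : Fin 4 ↦ if j k τ = j k' σ then (1 : ℂ) else 0) = 0 := by
      ext k k'
      simp only [Matrix.of_apply, Matrix.zero_apply, ite_eq_right_iff, one_ne_zero, imp_false]
      intro h
      exact hστ ((hj k k' τ σ h).2).symm
    rw [h0, Matrix.det_zero]
  · rw [hval, hF]
    have h1 : (Matrix.of fun k k' : Fin 4 ↦ if j k σ = j k' σ then (1 : ℂ) else 0) = 1 := by
      ext k k'
      simp only [Matrix.of_apply, Matrix.one_apply]
      by_cases hkk : k = k'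
      · subst hkk; simp
      · rw [if_neg (fun h ↦ hkk (hj k k' σ σ h).1), if_neg hkk]
    rw [h1, Matrix.det_one]

end Independence

end Summit.HodgeConjecture.CorCM.Model

end
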